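import Summits.Ventures.PercRepro.C025ProfileSplit

/-!
# C-033 «SHADOW HALL (H⁺)» — the row `q = 0` for EVERY finite matroid and EVERY family (night-3 g6)

`profileHall_zero (v) {𝒜} (h𝒜 : 𝒜 ⊆ Profile.Rq M 0) : ∑ B ∈ 𝒜, Profile.price M 0 v B ≤ #(Shadow.shadowLevel M v 𝒜)`:
the Hall form `ProfileHall` (C025Profile) at `q = 0` — for every family `𝒜` of rank-`0` sets (sets of loops), the rank-`v`
sets containing a member of `𝒜` number at least `#𝒜·[v ≤ ρ(E)]·C(ρ(E), v)`. Proof: the injection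
`(B, T) ↦ B ∪ T` (`B ∈ 𝒜`, `T` a `v`-subset of a fixed basis) into the shadow, as for `profileIneq_zero`
(C025ProfileSplit), whose target was the whole level.
-/

open scoped Matroid

namespace PercRepro

open Set Finset ThmH

section HallZero

variable {α : Type} [DecidableEq α] {M : Matroid α} [M.Finite]

/-- **`(H⁺_{0,v})` for every finite matroid and every family `𝒜` of rank-`0` sets**:
`#∂_v 𝒜 ≥ #𝒜·[v ≤ ρ(E)]·C(ρ(E), v)` — every `B ∈ 𝒜` (a set of loops) and every `v`-subset `T` of a fixed basis give a
distinct rank-`v` set `B ∪ T ⊇ B` of the shadow. -/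
theorem profileHall_zero (v : ℕ) {𝒜 : Finset (Finset α)} (h𝒜 : 𝒜 ⊆ Profile.Rq M 0) :
    ∑ B ∈ 𝒜, Profile.price M 0 v B ≤ ((Shadow.shadowLevel M v 𝒜).card : ℚ) := by
  classical
  have hRtop : M.eRank ≠ ⊤ := M.eRank_ne_top_iff.2 inferInstance
  set R := M.eRank.toNat with hR
  -- every rank-0 set has price [v ≤ R]·C(R, v)
  have hprice : ∀ B ∈ 𝒜, Profile.price M 0 v B = if v ≤ R then (Nat.choose R v : ℚ) else 0 := by
    intro B hB
    have hB := h𝒜 hB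
    rw [Profile.mem_Rq] at hB
    unfold Profile.price
    rw [eRk_compl_of_eRk_zero hB.1 (by exact_mod_cast hB.2), ← ENat.coe_toNat hRtop, ENat.toNat_coe]
    simp only [add_zero, Nat.choose_zero_right, Nat.cast_one, div_one]
    by_cases hv : v ≤ R
    · rw [if_pos (by exact_mod_cast hv), if_pos hv]
    · rw [if_neg (by exact_mod_cast hv), if_neg hv]
  rw [Finset.sum_congr rfl hprice, Finset.sum_const, nsmul_eq_mul]
  by_cases hv : v ≤ R
  · rw [if_pos hv]
    -- a basis as a finset
    obtain ⟨Bs, hBs⟩ := M.exists_isBase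
    have hBsfin : Bs.Finite := M.ground_finite.subset hBs.subset_ground
    set Bf : Finset α := hBsfin.toFinset with hBf
    have hBfc : Bf.card = R := by
      have h1 : M.eRank = Bs.encard := hBs.encard_eq_eRank.symm
      rw [hR, h1, ← hBsfin.coe_toFinset, Set.encard_coe_eq_coe_finsetCard, ENat.toNat_coe]
    have hBfg : Bf ⊆ gr M := by
      intro x hx
      rw [← Finset.mem_coe, coe_gr]
      exact hBs.subset_ground (by rw [← hBsfin.mem_toFinset]; exact hx)
    -- the injection (B, T) ↦ B ∪ T into the level
    have hmap : ∀ x ∈ 𝒜 ×ˢ Finset.powersetCard v Bf, x.1 ∪ x.2 ∈ Shadow.shadowLevel M v 𝒜 := by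
      rintro ⟨B, T⟩ hx
      rw [Finset.mem_product, Finset.mem_powersetCard] at hx
      have hB𝒜 := hx.1
      have hx1 := h𝒜 hx.1
      rw [Profile.mem_Rq] at hx1
      simp only [Shadow.shadowLevel, Finset.mem_filter]
      refine ⟨?_, B, hB𝒜, Finset.subset_union_left⟩
      rw [Profile.mem_levelSet]
      refine ⟨Finset.union_subset hx1.1 (hx.2.1.trans hBfg), ?_⟩
      rw [eRk_union_of_eRk_zero (by exact_mod_cast hx1.2)]
      have hind : M.Indep (T : Set α) := hBs.indep.subset (by
        intro x hx'; rw [← hBsfin.mem_toFinset]; exact hx.2.1 (by exact_mod_cast hx'))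
      rw [hind.eRk_eq_encard, Set.encard_coe_eq_coe_finsetCard, hx.2.2]
    have hinj : Set.InjOn (fun x : Finset α × Finset α => x.1 ∪ x.2)
        (𝒜 ×ˢ Finset.powersetCard v Bf : Finset (Finset α × Finset α)) := by
      rintro ⟨B, T⟩ hx ⟨B', T'⟩ hx' h
      simp only [Finset.coe_product, Set.mem_prod, Finset.mem_coe, Finset.mem_powersetCard] at hx hx'
      have hx1 := h𝒜 hx.1
      have hx'1 := h𝒜 hx'.1
      rw [Profile.mem_Rq] at hx1 hx'1
      simp only at h
      -- B = (B ∪ T) ∩ loops-part: T ∩ Bf-part. B ⊆ rank-0 sets are disjoint from the independent Bf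
      have hdisj : ∀ (B₀ T₀ : Finset α), B₀ ⊆ gr M → M.eRk (B₀ : Set α) = 0 → T₀ ⊆ Bf → Disjoint B₀ T₀ := by
        intro B₀ T₀ hB₀ h0 hT₀
        rw [Finset.disjoint_left]
        intro x hxB hxT
        have hind : M.Indep ({x} : Set α) := hBs.indep.subset (by
          intro y hy; rw [Set.mem_singleton_iff] at hy; subst hy; rw [← hBsfin.mem_toFinset]; exact hT₀ hxT)
        have h1 : M.eRk ({x} : Set α) ≤ M.eRk (B₀ : Set α) := M.eRk_mono (by simpa using hxB)
        rw [hind.eRk_eq_encard, Set.encard_singleton, h0] at h1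
        exact absurd h1 (by decide)
      have hB : B = (B ∪ T).filter (fun x => x ∉ Bf) := by
        ext x; simp only [Finset.mem_filter, Finset.mem_union]
        constructor
        · intro hxB
          refine ⟨Or.inl hxB, fun hxf => ?_⟩
          exact Finset.disjoint_left.1 (hdisj B Bf hx1.1 (by exact_mod_cast hx1.2) (subset_refl _)) hxB hxf
        · rintro ⟨hxBT | hxBT, hxf⟩
          · exact hxBT
          · exact absurd (hx.2.1 hxBT) hxf
      have hB' : B' = (B' ∪ T').filter (fun x => x ∉ Bf) := by
        ext x; simp only [Finset.mem_filter, Finset.mem_union]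
        constructor
        · intro hxB
          refine ⟨Or.inl hxB, fun hxf => ?_⟩
          exact Finset.disjoint_left.1 (hdisj B' Bf hx'1.1 (by exact_mod_cast hx'1.2) (subset_refl _)) hxB hxf
        · rintro ⟨hxBT | hxBT, hxf⟩
          · exact hxBT
          · exact absurd (hx'.2.1 hxBT) hxf
      have hT : T = (B ∪ T).filter (fun x => x ∈ Bf) := by
        ext x; simp only [Finset.mem_filter, Finset.mem_union]
        constructor
        · intro hxT; exact ⟨Or.inr hxT, hx.2.1 hxT⟩
        · rintro ⟨hxBT | hxBT, hxf⟩
          · exact absurd hxf (Finset.disjoint_left.1 (hdisj B Bf hx1.1 (by exact_mod_cast hx1.2) (subset_refl _)) hxBT)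
          · exact hxBT
      have hT' : T' = (B' ∪ T').filter (fun x => x ∈ Bf) := by
        ext x; simp only [Finset.mem_filter, Finset.mem_union]
        constructor
        · intro hxT; exact ⟨Or.inr hxT, hx'.2.1 hxT⟩
        · rintro ⟨hxBT | hxBT, hxf⟩
          · exact absurd hxf (Finset.disjoint_left.1 (hdisj B' Bf hx'1.1 (by exact_mod_cast hx'1.2) (subset_refl _)) hxBT)
          · exact hxBT
      rw [Prod.mk.injEq]
      exact ⟨by rw [hB, hB', h], by rw [hT, hT', h]⟩
    have hcard := Finset.card_le_card_of_injOn _ hmap hinj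
    rw [Finset.card_product, Finset.card_powersetCard, hBfc] at hcard
    exact_mod_cast hcard
  · rw [if_neg hv, mul_zero]
    exact Nat.cast_nonneg _

end HallZero

end PercRepro
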